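import Summits.BirchSwinnertonDyer.Rank1Residual.Additive.TwistPartnerRigidity
import Summits.BirchSwinnertonDyer.Rank1Residual.Additive.UnramifiedBaseChange
import Summits.BirchSwinnertonDyer.Rank1Residual.Additive.TameBranchRigidity
import HarnessLib

/-!
# Rigidity of the ordinary twist partner, NEWFORM AND CURVE LEVEL: a partner of `(f, χ)` forces
# `U_p[·]⁺_f = 0` and is unique for its unit; on the X4-3 locus the unit is pinned too; at an
# ADDITIVE prime the necessary condition holds (cell `b2b-bsdres`, sub-cell additive-p2 =
# X3♯(G-ord) / X4♯(G-ord), gen 23; sequel of `TwistPartnerRigidity.lean`)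

HONEST FRAMING (cell `b2b-bsdres`, run/shared/lean/b2b/bsd-rank1-residual/, verbatim in every
file): the goal of the cell is to DELETE the COMBINATION-SHAPED residual classes of the
Birch–Swinnerton-Dyer formula for ALL analytic-rank `≤ 1` elliptic curves over `ℚ` — "full BSD
formula for every rank `≤ 1` curve in class `C`" assembled STRICTLY from published theorems — so
that the rank-`≤ 1` remainder becomes exactly the CONSTRUCTION-SHAPED classes, which are TYPED
(missing-input `Prop`s), NOT attempted. This is not "finishing BSD". Sub-cell additive-p2: the
classes X3♯(G-ord) / X4♯(G-ord) are CONSTRUCTION-SHAPED and stay so; labels / RESIDUAL-MAP marks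
UNCHANGED; nothing is booked. THEOREMS ONLY (no definition, no named fact, no conjecture node).

## What

`TwistPartnerRigidity.lean` proved, for an arbitrary `1`-periodic `x : ℚ → ℚ_p` and `χ ≠ 1`: every
ordinary twist partner `(Φ, ã)` (`x = τ_{χ⁻¹}Φ`, `∑_d Φ(· + d/p) = ãΦ(p·)`) satisfies the functional
equation `Φ = (χ(−1)/p)τ_χ x + (ã/p)Φ(p·)`, forces `∑_d x(· + d/p) = 0`, and is UNIQUE for its unit
`ã`. Here `x = [·]⁺_f` (`ratPlusSymbol f`, read in `ℚ_p`), the currency of cc-typer-2's typed input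
`CensusX43.HasOrdinaryTwistPartner χ f` (`CensusX43ValueModule.lean`; on defect `e ∈ {3,4,6}`: the
symbol of Delbourgo's `p`-ordinary newform `f̃ = f_E ⊗ ε̄`, Delbourgo 1998 §1.5, Atkin–Li 1978):

* §1 `CensusX43.HasOrdinaryTwistPartner.sum_ratPlusSymbol_eq_zero` — a partner ⟹
  `∑_{d mod p} [s + d/p]⁺_f = 0` for all `s`; `CensusX43.HasOrdinaryTwistPartner.partner_unique` —
  two partners with the same unit coincide;
* §1 `CensusX43.eigenvalue_unique_of_ratPlusSymbol_zero_ne_zero` — **THE UNIT IS PINNED** on a row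
  with `[0]⁺_f ≠ 0` (`L(E,1) ≠ 0`: the X4-3 locus `r_an = 0`), `p` odd: two partners `(Φ, ã)`,
  `(Φ', ã')` with attained sup norms have `ã' = ã` AND `Φ' = Φ` — both yield E-normalised tame
  branches (`exists_isTameBranchOf_of_twistPartnerData`) with constant term `ã⁻¹[0]⁺_f ≠ 0`, and
  gen 21's tuple rigidity `IsTameBranchOf.tuple_eq` equates the units. So on defect 3,4,6 the typed
  input, WHEN inhabited, DETECTS the unit root `ã_p` of `f̃` (the ordinary prime `𝔭` of `ℚ(ζ_e)`);
* §2 `sum_ratPlusSymbol_add_div_eq_zero_of_addv` — at an ADDITIVE prime of `E = W` with newform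
  `f` the necessary condition HOLDS: `∑_d [s + d/p]⁺_f = 0` (`a_p(E) = 0`,
  `LFunction_apply_eq_zero_of_hasAdditiveReductionAt`, in the `U_p`-relation
  `a_p[r]⁺ = ∑_j[(r+j)/p]⁺`, `intCast_mul_ratPlusSymbol_of_dvd`, `p ∣ N` by `dvd_level_of_addv`).

With the companion `TwistPartnerForced.lean` (the forced partner written out and the iff
`HasOrdinaryTwistPartner χ f ↔ U_p[·]⁺_f = 0 ∧ ∃ ã unit, Φ_{f,χ,ã} bounded`) the defect-3/4/6
existence input of the tame-branch route is ONE boundedness statement about ONE explicit function.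

References: B. Mazur, J. Tate, J. Teitelbaum, Invent. Math. 84 (1986) §I.4 (4.2), §I.8, §I.10
[MazurTateTeitelbaum1986Invent]; A. O. L. Atkin, W. Li, Invent. Math. 48 (1978) §3 [AtkinLi1978];
D. Delbourgo, Compositio Math. 113 (1998) §1.5 [Delbourgo1998]; J. H. Silverman, AEC (2009) App. C
§16 [SilvermanAEC2009].
-/

noncomputable section

open scoped Classical MatrixGroups ModularForm

open CongruenceSubgroup

namespace Summit.BirchSwinnertonDyer.Rank1Residual.Additive

open Literature.NumberTheory.EllipticCurves Literature.NumberTheory.EllipticCurves.ModularForms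
  Literature.NumberTheory.EllipticCurves.Rank1Residual

/-! ### §1 Newform level: `x = [·]⁺_f` -/

section Newform

variable {p : ℕ} [hp : Fact p.Prime] {N : ℕ} {f : CuspForm (Gamma0 N) 2}
  {χ : MulChar (ZMod p) ℚ_[p]}

/-- **A partner for `(f, χ)` forces `U_p [·]⁺_f = 0`**: `HasOrdinaryTwistPartner χ f` (`χ ≠ 1`)
implies `∑_{d mod p} [s + d/p]⁺_f = 0` for every `s ∈ ℚ`. [folklore] -/
theorem CensusX43.HasOrdinaryTwistPartner.sum_ratPlusSymbol_eq_zero (hχ : χ ≠ 1)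
    (h : CensusX43.HasOrdinaryTwistPartner χ f) (s : ℚ) :
    ∑ d : ZMod p, ratPlusSymbol f (s + (d.val : ℚ) / p) = 0 := by
  obtain ⟨Φ, ã, -, hper, hx, hU, -⟩ := h
  have h0 := TwistPartner.sum_apply_add_div_eq_zero (x := fun r ↦ ((ratPlusSymbol f r : ℚ) : ℚ_[p]))
    hχ hper hx hU s
  exact_mod_cast h0

/-- **Uniqueness at newform level**: two partners of `(f, χ)` with the same unit `ã` coincide.
[folklore] -/
theorem CensusX43.HasOrdinaryTwistPartner.partner_unique (hχ : χ ≠ 1) {Φ Φ' : ℚ → ℚ_[p]}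
    {ã : ℚ_[p]} (hã : ‖ã‖ = 1)
    (hper : ∀ s, Φ (s + 1) = Φ s)
    (hx : ∀ s, ((ratPlusSymbol f s : ℚ) : ℚ_[p]) = CensusX43.twist χ⁻¹ Φ s)
    (hU : ∀ s, ∑ d : ZMod p, Φ (s + (d.val : ℚ) / p) = ã * Φ (p * s))
    (hper' : ∀ s, Φ' (s + 1) = Φ' s)
    (hx' : ∀ s, ((ratPlusSymbol f s : ℚ) : ℚ_[p]) = CensusX43.twist χ⁻¹ Φ' s)
    (hU' : ∀ s, ∑ d : ZMod p, Φ' (s + (d.val : ℚ) / p) = ã * Φ' (p * s)) : Φ' = Φ :=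
  TwistPartner.partner_unique (x := fun r ↦ ((ratPlusSymbol f r : ℚ) : ℚ_[p])) hχ hã hper hx hU
    hper' hx' hU'

/-- **THE EIGENVALUE IS PINNED** (`p` odd, `[0]⁺_f ≠ 0`, i.e. `L(E,1) ≠ 0` — the X4-3 locus
`r_an = 0`): two partners `(Φ, ã)`, `(Φ', ã')` of `(f, χ)` with attained sup norms have `ã' = ã` —
and hence `Φ' = Φ`. Both give E-normalised tame branches `B`, `B'`
(`exists_isTameBranchOf_of_twistPartnerData`) with `B(0) = ã⁻¹[0]⁺_f ≠ 0`; gen 21's tuple rigidity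
`IsTameBranchOf.tuple_eq` forces `ã' = ã`. So the bounded partner, when it exists, DETECTS the unit
root of Delbourgo's `f̃`. [cite: MazurTateTeitelbaum1986Invent, §I.10] -/
theorem CensusX43.eigenvalue_unique_of_ratPlusSymbol_zero_ne_zero (hp2 : p ≠ 2) (hχ : χ ≠ 1)
    (h0 : ratPlusSymbol f 0 ≠ 0) {Φ Φ' : ℚ → ℚ_[p]} {ã ã' : ℚ_[p]}
    (hã : ‖ã‖ = 1) (hper : ∀ s, Φ (s + 1) = Φ s)
    (hx : ∀ s, ((ratPlusSymbol f s : ℚ) : ℚ_[p]) = CensusX43.twist χ⁻¹ Φ s)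
    (hU : ∀ s, ∑ d : ZMod p, Φ (s + (d.val : ℚ) / p) = ã * Φ (p * s))
    (hmax : ∃ s₁, ∀ s, ‖Φ s‖ ≤ ‖Φ s₁‖)
    (hã' : ‖ã'‖ = 1) (hper' : ∀ s, Φ' (s + 1) = Φ' s)
    (hx' : ∀ s, ((ratPlusSymbol f s : ℚ) : ℚ_[p]) = CensusX43.twist χ⁻¹ Φ' s)
    (hU' : ∀ s, ∑ d : ZMod p, Φ' (s + (d.val : ℚ) / p) = ã' * Φ' (p * s))
    (hmax' : ∃ s₁, ∀ s, ‖Φ' s‖ ≤ ‖Φ' s₁‖) : ã' = ã ∧ Φ' = Φ := by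
  obtain ⟨s₁, hs₁⟩ := hmax
  obtain ⟨s₁', hs₁'⟩ := hmax'
  obtain ⟨B, hBall⟩ := exists_isTameBranchOf_of_twistPartnerData hχ hã hper hx hU hs₁
  obtain ⟨B', hBall'⟩ := exists_isTameBranchOf_of_twistPartnerData hχ hã' hper' hx' hU' hs₁'
  have hB : IsTameBranchOf f p (χ.ringHomComp (algebraMap ℚ_[p] ℂ_[p])) ã B := hBall.1
  have hB' : IsTameBranchOf f p (χ.ringHomComp (algebraMap ℚ_[p] ℂ_[p])) ã' B' := hBall'.1
  have hã0 : ã ≠ 0 := fun h ↦ by rw [h, norm_zero] at hã; exact zero_ne_one hã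
  have hã'0 : ã' ≠ 0 := fun h ↦ by rw [h, norm_zero] at hã'; exact zero_ne_one hã'
  have hB0 : B ≠ 0 := by
    intro hB0
    have hc := hB.2.1
    rw [hB0, map_zero] at hc
    have h0' : ((ratPlusSymbol f 0 : ℚ) : ℚ_[p]) ≠ 0 := by exact_mod_cast h0
    exact (mul_ne_zero (inv_ne_zero hã0) h0') hc.symm
  obtain ⟨-, hαα, -⟩ := IsTameBranchOf.tuple_eq hp2 hB hB' hB0 hã'0
  refine ⟨hαα, ?_⟩
  subst hαα
  exact CensusX43.HasOrdinaryTwistPartner.partner_unique hχ hã hper hx hU hper' hx' hU'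

end Newform

/-! ### §2 Curve level: the necessary condition holds at an additive prime -/

section Curve

variable {p : ℕ} [hp : Fact p.Prime] {N : ℕ} [NeZero N] {f : CuspForm (Gamma0 N) 2}
  (W : WeierstrassCurve ℚ) [W.IsElliptic]

/-- **An additive prime divides the level** of the newform of `W` (no Carayol): from the tree's
`IsNewformOf.primesEquiv_dvd_level_of_not_hasGoodReductionAt` at the place over `p`
(`hasAdditiveReductionAt_of_addv`). [folklore] -/
theorem dvd_level_of_addv (hf : IsNewformOf W f) (hadd : Addv W p) : p ∣ N := by
  have hv := hasAdditiveReductionAt_of_addv W p hadd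
  have h := hf.primesEquiv_dvd_level_of_not_hasGoodReductionAt hv.not_hasGoodReductionAt
  rwa [primesEquiv_symm_apply_coe p] at h

/-- **At an ADDITIVE prime `U_p [·]⁺_{f_E} = 0`**: for `W / ℚ` with neither good nor multiplicative
reduction at `p` and `f` its newform, `∑_{d mod p} [s + d/p]⁺_f = 0` for every `s ∈ ℚ` — `a_p(E) = 0`
(`LFunction_apply_eq_zero_of_hasAdditiveReductionAt`) in the `U_p`-relation `a_p[r]⁺ = ∑_j[(r+j)/p]⁺`
(`intCast_mul_ratPlusSymbol_of_dvd`, `p ∣ N`) at `r = ps`. So the necessary condition of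
`TwistPartner.sum_apply_add_div_eq_zero` is SATISFIED on every additive row (all defects).
[cite: MazurTateTeitelbaum1986Invent, §I.4 (4.2)] [cite: SilvermanAEC2009, App. C §16] -/
theorem sum_ratPlusSymbol_add_div_eq_zero_of_addv (hf : IsNewformOf W f) (hadd : Addv W p)
    (s : ℚ) : ∑ d : ZMod p, ratPlusSymbol f (s + (d.val : ℚ) / p) = 0 := by
  haveI : NeZero p := ⟨hp.out.ne_zero⟩
  have hp0 : (p : ℚ) ≠ 0 := Nat.cast_ne_zero.mpr hp.out.ne_zero
  have hMD := exists_nsmul_modularSymbol_mem_periodLattice_of_isNewform0 hf.1 hf.coeffField_eq_bot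
  have hrat := ratCast_ratPlusSymbol_of_maninDrinfeld hMD
  have hpN : p ∣ N := dvd_level_of_addv W hf hadd
  have hap : cuspCoeff f p = ((0 : ℤ) : ℂ) := by
    rw [hf.2 p, W.LFunction_apply_eq_zero_of_hasAdditiveReductionAt (primesEquiv_symm_apply_coe p)
      (hasAdditiveReductionAt_of_addv W p hadd) (dvd_refl p), Int.cast_zero]
  have h := intCast_mul_ratPlusSymbol_of_dvd p hf.1 hp.out hpN hap hrat (p * s)
  rw [Int.cast_zero, zero_mul] at h
  have hj : ∀ j : Fin p, ratPlusSymbol f ((p * s + ((j : ℕ) : ℚ)) / p) =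
      ratPlusSymbol f (s + ((j : ℕ) : ℚ) / p) := fun j ↦ by
    congr 1; field_simp
  simp_rw [hj] at h
  rw [sum_fin_eq_sum_zmod_val (fun k : ℕ ↦ ratPlusSymbol f (s + (k : ℚ) / p))] at h
  exact h.symm

/-- The same in `ℚ_p`-currency (the shape of `TwistPartner.sum_apply_add_div_eq_zero`). [folklore] -/
theorem sum_cast_ratPlusSymbol_add_div_eq_zero_of_addv (hf : IsNewformOf W f) (hadd : Addv W p)
    (s : ℚ) : ∑ d : ZMod p, ((ratPlusSymbol f (s + (d.val : ℚ) / p) : ℚ) : ℚ_[p]) = 0 := by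
  have h := sum_ratPlusSymbol_add_div_eq_zero_of_addv W hf hadd s
  exact_mod_cast congrArg (fun q : ℚ ↦ (q : ℚ_[p])) h

end Curve

end Summit.BirchSwinnertonDyer.Rank1Residual.Additive

end
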